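import Summits.QuantumAdvantage.QuantumAdvantage.Theorems.LivenessSeparationLawB
import Summits.QuantumAdvantage.QuantumAdvantage.Theorems.LivenessSeparationLawF
import Summits.QuantumAdvantage.QuantumAdvantage.Theorems.LivenessSeparationLawG

set_option linter.dupNamespace false

/-!
# LIVENESS SEPARATION, part L (lens 4, g28 cycle 4c) — the BLOCK RECTANGLE KILL for `t` quadratic cuts (class normal form ∘ LAW R from wins ∘ `t`-label rank)

Blocker `X = AbsorptionDial.NoPerfectPolyOdd` (item 28487); every CONSTANT rung «`t` quadratic registers» of the t-ladder (NODE-g28 §5f), uniformly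
in `t`: the (P3)_t step.  Registers `k`-form except a set `Q` of cuts (the quadratic ones) all OUTSIDE a flat block `[a₀, a₀+m)`; a residue class
`|v| ≡ τ (mod 3)` of the block on which `g₀ ∈ Q` is live; a disjoint-support rectangle INSIDE the class (every `X i ∪ Y w` is a class input) with
columns indexed by all `w ∈ (𝔽_p^{r+1})^t`, on which the exceptional register of the CLASS NORMAL FORM (part J: dead members of `Q` silenced, live
ones merged into `g₀`) fires as a row-dependent non-constant `t`-label table `G_i(j ↦ ⟨(1,a_i), N_j w_j + w₀_j⟩)`, `a` injective; then
`|ι| > (n+1)·2p^k + 1` forces a losing input of `y` (`loss_of_block_tLabelRectangle`).  Proof: `y` perfect ⇒ the normal form wins on the class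
(part J `winsOn_class_normalForm`) and is `k`-form except `g₀` ⇒ LAW R from the wins on the rectangle (part F `rectRank_le_of_winsOn`) bounds the
rank of `g₀`'s live pattern there by `(n+1)·2p^k + 1`, while part K (`rank_famPatT_flat_ge`) bounds it below by `|ι|`.  `t = 1` with one dead and one
live quadratic cut is T1's (P3) (NODE §5d), `t = 2` with the block the whole cube is T2′'s (P3)₂ (§5e).
-/

open Finset
open Summit.QuantumAdvantage.AdviceFreeQNC0
open Summit.QuantumAdvantage.QuantumAdvantage.Theorems.InnerDegreeDial

namespace Summit.QuantumAdvantage.QuantumAdvantage.Theorems.LivenessSeparation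

variable {p : ℕ} [Fact p.Prime] {n : ℕ}

/-- **THE BLOCK RECTANGLE KILL ((P3)_t, uniform in `t`).**  See the module docstring.  `Q` = the exceptional (e.g. quadratic) cuts, all outside the
block; `v₀` a reference input of the class `τ` at which `g₀ ∈ Q` is live (it fixes which members of `Q` are dead / live on the class, part J
`liveCut_fill_block_outside`); the registers outside `Q` are `k`-form; the rectangle `X i ∪ Y w` lies in the class; `hpat` is the firing pattern of
the merged register `mergeSet (silenceSet y Q_dead) g₀ Q_live` of the class normal form (by `classNormalForm_self` it reads
`y g₀ ⊕ ⨁_{g ∈ Q_live} y g`). -/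
theorem loss_of_block_tLabelRectangle (hp5 : 5 ≤ p) {k r t m : ℕ} {ι : Type*} [Fintype ι] (c : ℕ)
    (y : Fin (n + 1) → (Fin n → Bool) → Bool) (ρ : Fin n → Bool) (a₀ : ℕ) (h : a₀ + m ≤ n)
    (Q : Finset (Fin (n + 1))) (hQ : ∀ g ∈ Q, g.val ≤ a₀ ∨ a₀ + m ≤ g.val) (g₀ : Fin (n + 1)) (hg₀ : g₀ ∈ Q)
    (τ : ℕ) (v₀ : Fin m → Bool) (hv₀ : (univ.filter fun j => v₀ j = true).card % 3 = τ % 3)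
    (hlive₀ : liveCut c (fill ρ (blockEmb a₀ m h) v₀) g₀ = true)
    (lam : Fin (n + 1) → Fin k → Fin n → ZMod p) (F : Fin (n + 1) → (Fin k → ZMod p) → Bool)
    (hF : ∀ g, g ∉ Q → ∀ u, y g u = F g (fun j => ∑ i, if u i = true then lam g j i else 0))
    (X : ι → Fin n → Bool) (Y : (Fin t → Fin (r + 1) → ZMod p) → Fin n → Bool)
    (hd : ∀ i w l, ¬ (X i l = true ∧ Y w l = true))
    (hcl : ∀ i w, ∃ v : Fin m → Bool, (univ.filter fun j => v j = true).card % 3 = τ % 3 ∧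
      bor (X i) (Y w) = fill ρ (blockEmb a₀ m h) v)
    (G : ι → (Fin t → ZMod p) → Bool) (hG : ∀ i, ∃ b b', G i b ≠ G i b')
    (a : ι → Fin r → ZMod p) (ha : Function.Injective a) (w₀ : Fin t → Fin (r + 1) → ZMod p)
    (N N' : Fin t → Matrix (Fin (r + 1)) (Fin (r + 1)) (ZMod p)) (hN : ∀ j, N j * N' j = 1)
    (hpat : ∀ i w, mergeSet (silenceSet y (Q.filter fun g => liveCut c (fill ρ (blockEmb a₀ m h) v₀) g = false)) g₀
        ((Q.filter fun g => liveCut c (fill ρ (blockEmb a₀ m h) v₀) g = true).erase g₀) g₀ (bor (X i) (Y w))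
      = G i fun j => lineRep p r (a i) ⬝ᵥ ((N j).mulVec (w j) + w₀ j))
    (ht : (n + 1) * (p ^ k * 2) + 1 < Fintype.card ι) :
    ∃ u, ringWinU c y u = false := by
  classical
  generalize hQd : (Q.filter fun g => liveCut c (fill ρ (blockEmb a₀ m h) v₀) g = false) = Qd at hpat
  generalize hQl : (Q.filter fun g => liveCut c (fill ρ (blockEmb a₀ m h) v₀) g = true).erase g₀ = Ql at hpat
  by_contra hno
  push Not at hno
  have hperf : ∀ u, ringWinU c y u = true := fun u => by
    cases hu : ringWinU c y u
    · exact absurd hu (hno u)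
    · rfl
  -- the class normal form wins on the rectangle (part J)
  have hwin : ∀ i w, ringWinU c (mergeSet (silenceSet y Qd) g₀ Ql) (bor (X i) (Y w)) = true := by
    intro i w
    obtain ⟨v, hv, hb⟩ := hcl i w
    rw [hb, ← hQd, ← hQl]
    exact winsOn_class_normalForm c y hperf ρ a₀ h Q hQ g₀ hg₀ τ v₀ hv₀ hlive₀ v hv
  -- it is `k`-form except `g₀`
  have hF' : ∀ g, g ≠ g₀ → ∀ u, mergeSet (silenceSet y Qd) g₀ Ql g u
      = (fun g => if g ∈ Q then (fun _ => false) else F g) g (fun j => ∑ i, if u i = true then lam g j i else 0) := by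
    intro g hg u
    by_cases hq : g ∈ Q
    · simp only [hq, if_true]
      refine classNormalForm_of_mem y ?_ hg u
      rw [← hQd, ← hQl]
      cases hl : liveCut c (fill ρ (blockEmb a₀ m h) v₀) g
      · exact Or.inl (mem_filter.mpr ⟨hq, hl⟩)
      · exact Or.inr (mem_erase.mpr ⟨hg, mem_filter.mpr ⟨hq, hl⟩⟩)
    · simp only [hq, if_false]
      have hnd : g ∉ Qd := by
        rw [← hQd]
        exact fun hm => hq (mem_filter.mp hm).1
      have hnl : g ∉ Ql := by
        rw [← hQl]
        exact fun hm => hq (mem_filter.mp (mem_erase.mp hm).2).1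
      rw [classNormalForm_of_not_mem y hnd hnl hg u]
      exact hF g hq u
  -- LAW R from the wins on the rectangle (part F)
  have hR := rectRank_le_of_winsOn hp5 c (mergeSet (silenceSet y Qd) g₀ Ql) g₀ lam
    (fun g => if g ∈ Q then (fun _ => false) else F g) hF' X Y hd hwin
  -- `g₀` is live on the rectangle (constancy of liveness on the class, part J)
  have hliveR : ∀ i w, liveCut c (bor (X i) (Y w)) g₀ = true := by
    intro i w
    obtain ⟨v, hv, hb⟩ := hcl i w
    rw [hb, liveCut_fill_block_outside c ρ a₀ h g₀ (hQ g₀ hg₀) v v₀ (by rw [hv, hv₀])]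
    exact hlive₀
  -- the rectangle is the `t`-label family pattern (part K)
  have hrect : rect (Kp p) (fun u => mergeSet (silenceSet y Qd) g₀ Ql g₀ u && liveCut c u g₀) X Y
      = Matrix.of fun i (w : Fin t → Fin (r + 1) → ZMod p) =>
          (fun i z => if G i z = true then (1 : Kp p) else 0) i
            fun j => lineRep p r (a i) ⬝ᵥ ((N j).mulVec (w j) + w₀ j) := by
    ext i w
    rw [rect, Matrix.of_apply, Matrix.of_apply]
    simp only [hpat i w, hliveR i w, Bool.and_true]
  obtain ⟨hK, ω, -, hω, -⟩ := Coset21.exists_charTwo_roots p hp5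
  haveI := hK
  have hG' : ∀ i, ∃ x x', (fun i z => if G i z = true then (1 : Kp p) else 0) i x
      ≠ (fun i z => if G i z = true then (1 : Kp p) else 0) i x' := by
    intro i
    obtain ⟨b, b', hb⟩ := hG i
    refine ⟨b, b', ?_⟩
    intro h
    apply hb
    cases h1 : G i b <;> cases h2 : G i b' <;> simp_all
  have hge := rank_famPatT_flat_ge hp5 hω a ha (fun i z => if G i z = true then (1 : Kp p) else 0) hG' w₀ N N' hN
  rw [← hrect] at hge
  omega

end Summit.QuantumAdvantage.QuantumAdvantage.Theorems.LivenessSeparation
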